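import Summits.HodgeConjecture.HodgeConjecture.Theorems.K2E3CentralTransferVanishingLocalSplit        -- ★ p855713 (this seat): T0-loc `centralTransferVanishingLocal_split_of_HC1Ploc`
import Summits.HodgeConjecture.HodgeConjecture.Theorems.K2E3GLTwoCentralDensityRamifiedTorusLocal  -- ★ p855747 (this seat, K2E4-p01 (g2)'s proof): (HC₁^P-loc)
import HarnessLib

/-!
# Socket B_loc^{split} `sig_K2E3CentralTransferVanishingLocalSplit` (U3b ED. 3, K2E4-p06 (g2) cand 3db95eaa) — PAID OUTRIGHT at every split place:
# T0-loc ∘ (HC₁^P-loc)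

Cell `pub/hodgecm-mathlib`, squad K2 (engine E3, dealer K2E3-plan (g1) ruling 23:32:58Z (g)), seat K2E4-p02 (g0); `--supports stmt-HodgeConjecture-24833 --as helper`.
THEOREMS ONLY.  `centralTransferVanishingLocal_split : ‹(B_loc) bytes with «¬ Subsingleton (PlacesOver L v) →» after the canonical hypotheses›` — the LOCAL
Harish-Chandra density at the `H`-central point at a split place (road J's J4 there): ★ p855713 `centralTransferVanishingLocal_split_of_HC1Ploc` applied to
★ p855747 `K2E3GLTwoCentralDensityRamifiedTorusLocal.apply_scalar_eq_zero_of_eventually_orbitalIntegral_eq_zero`.  Socket U3b-a ∣ split (★ p855707) is the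
special case of an everywhere-vanishing hypothesis (★ p855519 §2).

HONEST LABEL: HC_CM is proved only modulo the 7 printed citations (2 remaining named inputs: hLiu418 = stmt-HodgeConjecture-24832, h413 =
stmt-HodgeConjecture-24833) until rung 0 closes; this file pays the SPLIT half of socket U3b-d (B_loc) only.

## References
* [Rogawski1990] J. D. Rogawski, *Automorphic Representations of Unitary Groups in Three Variables*, Ann. of Math. Stud. 123 (1990), §4.3 (4.3.1) p. 43, §8.1 pp. 112–117.
* [HarishChandra1999AdmissibleDistributions] Harish-Chandra, *Admissible invariant distributions on reductive p-adic groups*, AMS ULS 16 (1999), Thm. 3.1.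
-/

set_option autoImplicit false

set_option linter.dupNamespace false

noncomputable section

open MeasureTheory Measure NumberField IsDedekindDomain Matrix Polynomial
open Literature.MeasureTheory.Group
open Literature.NumberTheory.Rogawski1990 Literature.NumberTheory.Automorphic Literature.NumberTheory.GaloisRepresentations
open Literature.AlgebraicGeometry.ShimuraVarieties (unitaryGroup hermForm)
open scoped MatrixGroups Topology
open Filter

namespace Summit.HodgeConjecture.HodgeConjecture.Cruxes.H413.K2E3CentralTransferVanishingSplit

/-- **Socket B_loc^{split} (U3b ED. 3) — the local Harish-Chandra density at the `H`-centre at a SPLIT place, unconditional.**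
[cite: Rogawski1990, §4.3 (4.3.1) p. 43; §8.1 pp. 112–117] [cite: HarishChandra1999AdmissibleDistributions, Thm. 3.1] -/
theorem centralTransferVanishingLocal_split :
    ∀ (L : Type) [Field L] [NumberField L] [IsCMField L] (H' : Matrix (Fin 3) (Fin 3) L),
      (H'.map (cmConjRingHom L)).transpose = H' →
      (∀ x : Fin 3 → L, hermForm (cmConjRingHom L) H' x x = 0 → x = 0) →
    ∀ (v : HeightOneSpectrum (𝓞 ↥(maximalRealSubfield L)))
      [MeasurableSpace ((UnitaryGroup.cmDatum L 2 (Matrix.of fun i j : Fin 2 => if i.val + j.val + 1 = 2 then (1 : L) else 0)).Local v × (UnitaryGroup.cmDatum L 1 (Matrix.of fun i j : Fin 1 => if i.val + j.val + 1 = 1 then (1 : L) else 0)).Local v)] [BorelSpace ((UnitaryGroup.cmDatum L 2 (Matrix.of fun i j : Fin 2 => if i.val + j.val + 1 = 2 then (1 : L) else 0)).Local v × (UnitaryGroup.cmDatum L 1 (Matrix.of fun i j : Fin 1 => if i.val + j.val + 1 = 1 then (1 : L) else 0)).Local v)]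
      [∀ a : (UnitaryGroup.cmDatum L 2 (Matrix.of fun i j : Fin 2 => if i.val + j.val + 1 = 2 then (1 : L) else 0)).Local v × (UnitaryGroup.cmDatum L 1 (Matrix.of fun i j : Fin 1 => if i.val + j.val + 1 = 1 then (1 : L) else 0)).Local v,
        MeasurableSpace (((UnitaryGroup.cmDatum L 2 (Matrix.of fun i j : Fin 2 => if i.val + j.val + 1 = 2 then (1 : L) else 0)).Local v × (UnitaryGroup.cmDatum L 1 (Matrix.of fun i j : Fin 1 => if i.val + j.val + 1 = 1 then (1 : L) else 0)).Local v) ⧸ Subgroup.centralizer ({a} : Set ((UnitaryGroup.cmDatum L 2 (Matrix.of fun i j : Fin 2 => if i.val + j.val + 1 = 2 then (1 : L) else 0)).Local v × (UnitaryGroup.cmDatum L 1 (Matrix.of fun i j : Fin 1 => if i.val + j.val + 1 = 1 then (1 : L) else 0)).Local v)))]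
      [∀ a : (UnitaryGroup.cmDatum L 2 (Matrix.of fun i j : Fin 2 => if i.val + j.val + 1 = 2 then (1 : L) else 0)).Local v × (UnitaryGroup.cmDatum L 1 (Matrix.of fun i j : Fin 1 => if i.val + j.val + 1 = 1 then (1 : L) else 0)).Local v,
        BorelSpace (((UnitaryGroup.cmDatum L 2 (Matrix.of fun i j : Fin 2 => if i.val + j.val + 1 = 2 then (1 : L) else 0)).Local v × (UnitaryGroup.cmDatum L 1 (Matrix.of fun i j : Fin 1 => if i.val + j.val + 1 = 1 then (1 : L) else 0)).Local v) ⧸ Subgroup.centralizer ({a} : Set ((UnitaryGroup.cmDatum L 2 (Matrix.of fun i j : Fin 2 => if i.val + j.val + 1 = 2 then (1 : L) else 0)).Local v × (UnitaryGroup.cmDatum L 1 (Matrix.of fun i j : Fin 1 => if i.val + j.val + 1 = 1 then (1 : L) else 0)).Local v)))]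
      [MeasurableSpace ((UnitaryGroup.cmDatum L 3 H').Local v)] [BorelSpace ((UnitaryGroup.cmDatum L 3 H').Local v)]
      [∀ γ : (UnitaryGroup.cmDatum L 3 H').Local v, MeasurableSpace ((UnitaryGroup.cmDatum L 3 H').Local v ⧸ Subgroup.centralizer ({γ} : Set ((UnitaryGroup.cmDatum L 3 H').Local v)))]
      [∀ γ : (UnitaryGroup.cmDatum L 3 H').Local v, BorelSpace ((UnitaryGroup.cmDatum L 3 H').Local v ⧸ Subgroup.centralizer ({γ} : Set ((UnitaryGroup.cmDatum L 3 H').Local v)))]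
      (νHv : Measure ((UnitaryGroup.cmDatum L 2 (Matrix.of fun i j : Fin 2 => if i.val + j.val + 1 = 2 then (1 : L) else 0)).Local v × (UnitaryGroup.cmDatum L 1 (Matrix.of fun i j : Fin 1 => if i.val + j.val + 1 = 1 then (1 : L) else 0)).Local v)) (νGv : Measure ((UnitaryGroup.cmDatum L 3 H').Local v))
      [IsFiniteMeasureOnCompacts νHv] [νHv.IsMulRightInvariant] [νGv.IsHaarMeasure] [νGv.IsMulRightInvariant]
      (Δv : LocalTransferFactor L H' v)
      (mHv : OrbitalMeasureFamily ((UnitaryGroup.cmDatum L 2 (Matrix.of fun i j : Fin 2 => if i.val + j.val + 1 = 2 then (1 : L) else 0)).Local v × (UnitaryGroup.cmDatum L 1 (Matrix.of fun i j : Fin 1 => if i.val + j.val + 1 = 1 then (1 : L) else 0)).Local v)) (mGv : OrbitalMeasureFamily ((UnitaryGroup.cmDatum L 3 H').Local v)),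
      IsLocalTransferDatum L H' v Δv mHv mGv →
      mHv.IsCanonical (IsLocalGRegular L v) νHv →
      mGv.IsCanonical (fun γ : (UnitaryGroup.cmDatum L 3 H').Local v => IsRegularElt (γ.val : GL (Fin 3) (UnitaryGroup.LocalRing L v))) νGv →
      ¬ Subsingleton (UnitaryGroup.PlacesOver L v) →
    ∀ (γH : (UnitaryGroup.cmDatum L 2 (Matrix.of fun i j : Fin 2 => if i.val + j.val + 1 = 2 then (1 : L) else 0)).Rational × (UnitaryGroup.cmDatum L 1 (Matrix.of fun i j : Fin 1 => if i.val + j.val + 1 = 1 then (1 : L) else 0)).Rational) (e₁ : L),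
      (((γH.1 : unitaryGroup (cmConjRingHom L) (Matrix.of fun i j : Fin 2 => if i.val + j.val + 1 = 2 then (1 : L) else 0)).val : GL (Fin 2) L) : Matrix (Fin 2) (Fin 2) L) =
        e₁ • (1 : Matrix (Fin 2) (Fin 2) L) →
    ∀ gH : (UnitaryGroup.cmDatum L 2 (Matrix.of fun i j : Fin 2 => if i.val + j.val + 1 = 2 then (1 : L) else 0)).Local v × (UnitaryGroup.cmDatum L 1 (Matrix.of fun i j : Fin 1 => if i.val + j.val + 1 = 1 then (1 : L) else 0)).Local v → ℂ, IsLocSmooth gH →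
      (∀ᶠ γ in 𝓝[{γ : (UnitaryGroup.cmDatum L 2 (Matrix.of fun i j : Fin 2 => if i.val + j.val + 1 = 2 then (1 : L) else 0)).Local v × (UnitaryGroup.cmDatum L 1 (Matrix.of fun i j : Fin 1 => if i.val + j.val + 1 = 1 then (1 : L) else 0)).Local v | IsLocalGRegular L v γ}]
          ((UnitaryGroup.cmDatum L 2 (Matrix.of fun i j : Fin 2 => if i.val + j.val + 1 = 2 then (1 : L) else 0)).toLocal v ((UnitaryGroup.cmDatum L 2 (Matrix.of fun i j : Fin 2 => if i.val + j.val + 1 = 2 then (1 : L) else 0)).toAdelic γH.1),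
            (UnitaryGroup.cmDatum L 1 (Matrix.of fun i j : Fin 1 => if i.val + j.val + 1 = 1 then (1 : L) else 0)).toLocal v ((UnitaryGroup.cmDatum L 1 (Matrix.of fun i j : Fin 1 => if i.val + j.val + 1 = 1 then (1 : L) else 0)).toAdelic γH.2)),
        stableOrbitalIntegralRel (IsLocalStablyConjH L v) mHv gH γ = 0) →
      gH ((UnitaryGroup.cmDatum L 2 (Matrix.of fun i j : Fin 2 => if i.val + j.val + 1 = 2 then (1 : L) else 0)).toLocal v ((UnitaryGroup.cmDatum L 2 (Matrix.of fun i j : Fin 2 => if i.val + j.val + 1 = 2 then (1 : L) else 0)).toAdelic γH.1),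
            (UnitaryGroup.cmDatum L 1 (Matrix.of fun i j : Fin 1 => if i.val + j.val + 1 = 1 then (1 : L) else 0)).toLocal v ((UnitaryGroup.cmDatum L 1 (Matrix.of fun i j : Fin 1 => if i.val + j.val + 1 = 1 then (1 : L) else 0)).toAdelic γH.2)) = 0 := by
  refine centralTransferVanishingLocal_split_of_HC1Ploc ?_
  intro F _ _ _ _ _ _ _ _ _ _ _ ν _ _ ψ hψ z c hO
  exact K2E3GLTwoCentralDensityRamifiedTorusLocal.apply_scalar_eq_zero_of_eventually_orbitalIntegral_eq_zero ν ψ hψ z c hO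

end Summit.HodgeConjecture.HodgeConjecture.Cruxes.H413.K2E3CentralTransferVanishingSplit

end
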